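import Mathlib
import Literature.Analysis.ODE.VariationalEnclosureComposition
import Literature.Analysis.ODE.HighOrderChainOpenDomain
import HarnessLib

/-!
# A chain of C¹ high-order enclosure steps: the Jacobian of the flow on the whole grid

One step of a `C¹` validated integrator (Zgliczyński 2002; Walawska–Wilczak 2016 §2) takes
`[x_k] ∋ φ(t_k, [x₀])` and `[V_k] ∋ ψ(t_k, [x₀], [V₀])`, validates a rough enclosure over
`[t_k, t_k + h_k]` computed with initial matrix `Id`, and propagates
`[V_{k+1}] ⊇ ψ(h_k, [x_k], Id) · [V_k] ∋ ψ(t_k + h_k, x₀, V₀)` by the linearity identity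
`ψ(t_k + h_k, x₀, V₀) = ψ(h_k, φ(t_k, x₀), Id) · ψ(t_k, x₀, V₀)` (WW2016 §2.1).  This file chains
the per-step theorems of `VariationalEnclosureIntervalTest.lean` (the box-data `C¹` HOE test)
and `VariationalEnclosureComposition.lean` (`ψ(t,x,M) = ψ(t,x,Id)·M`) along a mesh
`0 = τ 0 ≤ τ 1 ≤ … ≤ τ N`, exactly as `HighOrderChainOpenDomain.lean` chains the `C⁰` steps: the
variational system is ONE autonomous system `u' = F(u)`, `F(y, V) = (f y, Df(y) ∘ V)` on the
product space `ℝ^ι × L(ℝ^ι)` (WW2016 §1: "the extended system"), to which the abstract chain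
lemmas `exists_solution_of_stepChain` / `solution_mem_of_stepChain` (`StepChain.lean`) apply.

## Main result

`variationalChain_boxes_smoothOn_local`: `f ∈ C^∞(Ω)`, `Ω` open; per step `j < N` box data
`W j, S j ⊆ Ω, V j, E j i, EV j i, AK j, VV j, NN j` passing the `C⁰` test
`∑_{i<K} (T j)^i·E j i + (T j)^K·V j ⊆ S j` and the `C¹` test
`∑_{i<K} (T j)^i·EV j i + (T j)^K·NN j ⊆ VV j` (`NN j ⊇ AK j · VV j`, `T j ⊇ [0, h_j]`,
`h_j = τ (j+1) - τ j`), the state landing `∑_{i<K} h_j^i·E j i + h_j^K·V j ⊆ W (j+1)` and the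
JACOBIAN LANDING `(∑_{i<K} h_j^i·EV j i + h_j^K·NN j) · 𝒱 j ⊆ 𝒱 (j+1)` (interval matrix
product).  Then for every `y₀ ∈ W 0` and every initial operator `M₀ ∈ 𝒱 0` (entrywise): a
solution pair of `y' = f(y)`, `V' = Df(y) ∘ V` from `(y₀, M₀)` exists on `[0, τ N]`, and EVERY
solution pair `(y, J)` from `(y₀, M₀)` satisfies `y (τ j) ∈ W j`, `J (τ j) ∈ 𝒱 j` (`j ≤ N`) and,
on `[τ j, τ (j+1)]`: `y t ∈ S j`, `y t ∈ ∑ (T j)^i·E j i + (T j)^K·V j`, `J t ∈ VV j · 𝒱 j` and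
`J t ∈ (∑ (T j)^i·EV j i + (T j)^K·NN j) · 𝒱 j`, entrywise.  With `M₀ = Id` this bounds the
derivative of the flow `Dφ_t(y₀) = ψ(t, y₀, Id)` over the whole grid.

## References

* I. Walawska, D. Wilczak, *An implicit algorithm for validated enclosures of the solutions to
  variational equations for ODEs*, Appl. Math. Comput. 291 (2016) (arXiv:1509.07388), §1
  (the system `x' = f(x)`, `V' = Df(x)·V`, `x(0) ∈ [x₀]`, `V(0) ∈ [V₀]`; "the extended
  system"), §2 (one step: `[x_k]`, `[V_k]` ↦ `[x_{k+1}]`, `[V_{k+1}]`), §2.1 (linearity identity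
  and the inclusion over interval sets). [WalawskaWilczak2016]
* P. Zgliczyński, *C¹ Lohner algorithm*, Found. Comput. Math. 2 (2002) 429–465.
  [Zgliczynski2002C1Lohner]
* R. E. Moore, *Methods and Applications of Interval Analysis*, SIAM 1979, §8.1 (8.10), (8.13)
  (continuation of enclosures over a mesh). [Moore1979]
* N. S. Nedialkov, K. R. Jackson, G. F. Corliss, *Validated solutions of initial value problems
  for ordinary differential equations*, Appl. Math. Comput. 105 (1999), §3, §5 Algorithm I.
  [NedialkovJacksonCorliss1999]
* G. Teschl, *Ordinary Differential Equations and Dynamical Systems*, AMS 2012, §3.4 (3.88).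
  [Teschl2012]
-/

noncomputable section

open Set Metric Filter Topology TopologicalSpace NonemptyInterval

open scoped NNReal ContDiff

namespace Literature.Analysis.ODE

/-! ### The variational system as one autonomous system on the product space -/

section Product

variable {E : Type*} [NormedAddCommGroup E] [NormedSpace ℝ E]

/-- The **extended (variational) system** as an autonomous vector field on the product space
`E × L(E)`: `F(y, V) = (f y, f'(y) ∘ V)`. [cite: WalawskaWilczak2016, §1 (the system x' = f(x), V' = Df(x)·V; "the extended system")] -/
def variationalField (f : E → E) (f' : E → E →L[ℝ] E) (u : E × (E →L[ℝ] E)) : E × (E →L[ℝ] E) :=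
  (f u.1, (f' u.1).comp u.2)

/-- A solution pair `(z, J)` of `z' = f(z)`, `J' = f'(z) ∘ J` is a solution of the extended
system. [cite: WalawskaWilczak2016, §1 (the system x' = f(x), V' = Df(x)·V; "the extended system")] -/
theorem hasDerivWithinAt_variationalField_pair {f : E → E} {f' : E → E →L[ℝ] E} {z : ℝ → E}
    {J : ℝ → E →L[ℝ] E} {s : Set ℝ} {t : ℝ} (hz : HasDerivWithinAt z (f (z t)) s t)
    (hJ : HasDerivWithinAt J ((f' (z t)).comp (J t)) s t) :
    HasDerivWithinAt (fun t => (z t, J t)) (variationalField f f' (z t, J t)) s t :=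
  hz.prodMk hJ

/-- The state component of a solution of the extended system solves `z' = f(z)`.
[cite: WalawskaWilczak2016, §1 (the system x' = f(x), V' = Df(x)·V; "the extended system")] -/
theorem hasDerivWithinAt_fst_of_variationalField {f : E → E} {f' : E → E →L[ℝ] E}
    {u : ℝ → E × (E →L[ℝ] E)} {s : Set ℝ} {t : ℝ}
    (hu : HasDerivWithinAt u (variationalField f f' (u t)) s t) :
    HasDerivWithinAt (fun t => (u t).1) (f (u t).1) s t :=
  (ContinuousLinearMap.fst ℝ E (E →L[ℝ] E)).hasFDerivAt.comp_hasDerivWithinAt t hu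

/-- The matrix component of a solution of the extended system solves `J' = f'(z) ∘ J` along
its state component. [cite: WalawskaWilczak2016, §1 (the system x' = f(x), V' = Df(x)·V; "the extended system")] -/
theorem hasDerivWithinAt_snd_of_variationalField {f : E → E} {f' : E → E →L[ℝ] E}
    {u : ℝ → E × (E →L[ℝ] E)} {s : Set ℝ} {t : ℝ}
    (hu : HasDerivWithinAt u (variationalField f f' (u t)) s t) :
    HasDerivWithinAt (fun t => (u t).2) ((f' (u t).1).comp (u t).2) s t :=
  (ContinuousLinearMap.snd ℝ E (E →L[ℝ] E)).hasFDerivAt.comp_hasDerivWithinAt t hu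

end Product

/-! ### The C¹ chain over a mesh -/

section Chain

variable {ι : Type*} [Fintype ι] [DecidableEq ι] {Ω : Opens (ι → ℝ)} {f : (ι → ℝ) → ι → ℝ}
  (hf : ContDiffOn ℝ ∞ f (Ω : Set (ι → ℝ)))

omit [Fintype ι] in
/-- The entries of the Jacobian Taylor sum are the Taylor sums of the entries. [folklore] -/
private theorem taylorSum_apply_single' (Φ' : ℕ → (ι → ℝ) →L[ℝ] (ι → ℝ))
    (N : (ι → ℝ) →L[ℝ] (ι → ℝ)) (K : ℕ) (t : ℝ) :
    (fun i j => ((∑ k ∈ Finset.range K, t ^ k • Φ' k) + t ^ K • N) (Pi.single j 1) i) =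
      (∑ k ∈ Finset.range K, t ^ k • fun i j => Φ' k (Pi.single j 1) i) +
        t ^ K • fun i j => N (Pi.single j 1) i := by
  ext i j
  simp only [_root_.add_apply, _root_.sum_apply, _root_.smul_apply, Finset.sum_apply,
    Pi.smul_apply, Pi.add_apply, smul_eq_mul]

omit [Fintype ι] [DecidableEq ι] in
/-- Membership is transported along containment of interval matrices. [folklore] -/
private theorem mem_of_imat_le {A A' : ι → ι → NonemptyInterval ℝ} (h : A ≤ A') {a : ι → ι → ℝ}
    (ha : ∀ i l, a i l ∈ A i l) : ∀ i l, a i l ∈ A' i l :=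
  (mem_matBoxSet_iff (A := A')).1 (matBoxSet_mono h ((mem_matBoxSet_iff (A := A)).2 ha))

include hf in
/-- A Jacobian Taylor sum `∑_{k<K} t^k Φ_k'(x) + t^K N` with `Φ_k'(x) ∈ EV k`, `N ∈ NN`
(entrywise) and `t ∈ T` has entries in `∑_{k<K} T^k·EV k + T^K·NN`. [folklore] -/
private theorem jacTaylorSum_single_mem {K : ℕ}
    {T : NonemptyInterval ℝ} {t : ℝ} (ht : t ∈ T) {EV : ℕ → ι → ι → NonemptyInterval ℝ}
    {NN : ι → ι → NonemptyInterval ℝ} {x : ι → ℝ}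
    (hEV : ∀ k < K, ∀ a l, smoothTaylorFDeriv hf k x (Pi.single l 1) a ∈ EV k a l)
    {N : (ι → ℝ) →L[ℝ] (ι → ℝ)} (hN : ∀ a l, N (Pi.single l 1) a ∈ NN a l)
    {J₁ : (ι → ℝ) →L[ℝ] (ι → ℝ)}
    (hJ₁ : J₁ = (∑ k ∈ Finset.range K, t ^ k • smoothTaylorFDeriv hf k x) + t ^ K • N) :
    ∀ a l, J₁ (Pi.single l 1) a ∈ hoeMatBox T EV NN K a l := by
  have hmem := jacTaylorSum_mem_hoeMatBox (EV := EV) (NN := NN) (K := K) ht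
    (e := fun k => fun a l => smoothTaylorFDeriv hf k x (Pi.single l 1) a)
    (fun k hk => (mem_matBoxSet_iff (A := EV k)).2 fun a l => hEV k hk a l)
    ((mem_matBoxSet_iff (A := NN)).2 hN)
  rw [← taylorSum_apply_single', ← hJ₁] at hmem
  exact (mem_matBoxSet_iff (A := hoeMatBox T EV NN K)).1 hmem

/-- **A chain of `C¹` high-order enclosure steps encloses every solution pair on the whole
grid** (Zgliczyński 2002; Walawska–Wilczak 2016 §2: `[x_k], [V_k] ↦ [x_{k+1}], [V_{k+1}]` with
`[V_{k+1}] ⊇ ψ(h_k,[x_k],Id)·[V_k]`; continuation over a mesh as in Moore 1979 (8.13)).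
Field `f ∈ C^∞(Ω)`, `Ω` open; mesh `0 = τ 0 ≤ … ≤ τ N`, `h_j = τ (j+1) - τ j`, `T j ⊇ [0, h_j]`;
per step `j < N`: boxes `W j` (states at `τ j`), `S j ⊆ Ω` (a-priori), `E j i ⊇ Φ_i(W j)`
(`i < K`), `V j ⊇ Φ_K(S j)`, interval matrices `EV j i ∋ Φ_i'(x)` (`x ∈ W j`, `i < K`),
`AK j ∋ Φ_K'(z)` (`z ∈ S j`), `NN j ⊇ AK j · VV j`, the two tests
`∑_{i<K} (T j)^i·E j i + (T j)^K·V j ⊆ S j`, `∑_{i<K} (T j)^i·EV j i + (T j)^K·NN j ⊆ VV j`, the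
state landing `∑_{i<K} h_j^i·E j i + h_j^K·V j ⊆ W (j+1)` and the Jacobian landing
`(∑_{i<K} h_j^i·EV j i + h_j^K·NN j) · 𝒱 j ⊆ 𝒱 (j+1)`.  Then for `y₀ ∈ W 0` and `M₀ ∈ 𝒱 0`
(entrywise): a solution pair from `(y₀, M₀)` exists on `[0, τ N]`, and EVERY solution pair
`(y, J)` from `(y₀, M₀)` has `y (τ j) ∈ W j`, `J (τ j) ∈ 𝒱 j` (`j ≤ N`) and, for
`t ∈ [τ j, τ (j+1)]`: `y t ∈ S j`, `y t ∈ ∑ (T j)^i·E j i + (T j)^K·V j`, `J t ∈ VV j · 𝒱 j` and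
`J t ∈ (∑ (T j)^i·EV j i + (T j)^K·NN j) · 𝒱 j` (entrywise).
[cite: WalawskaWilczak2016, §2 (one step of the C¹ algorithm) and §2.1 (inclusion ψ(t_k+h_k, X₀, V₀) ⊂ ψ(h_k, X_k, Id)·V_k over interval sets)]
[cite: Zgliczynski2002C1Lohner] [cite: Moore1979, §8.1 eqs. (8.10), (8.13)]
[cite: NedialkovJacksonCorliss1999, §5 Algorithm I] [cite: Teschl2012, §3.4 eq. (3.88)] -/
theorem variationalChain_boxes_smoothOn_local {K : ℕ} (hK : 0 < K) {τ : ℕ → ℝ} (N : ℕ)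
    (hτ0 : τ 0 = 0) (hτ : ∀ j < N, τ j ≤ τ (j + 1)) (T : ℕ → NonemptyInterval ℝ)
    (hT : ∀ j < N, ∀ t ∈ Icc 0 (τ (j + 1) - τ j), t ∈ T j)
    (W S V : ℕ → ι → NonemptyInterval ℝ) (E : ℕ → ℕ → ι → NonemptyInterval ℝ)
    (EV : ℕ → ℕ → ι → ι → NonemptyInterval ℝ) (AK VV NN 𝒱 : ℕ → ι → ι → NonemptyInterval ℝ)
    (hSΩ : ∀ j < N, boxSet (S j) ⊆ Ω)
    (hE : ∀ j < N, ∀ i < K, MapsTo (smoothTaylorMap hf i) (boxSet (W j)) (boxSet (E j i)))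
    (hV : ∀ j < N, MapsTo (smoothTaylorMap hf K) (boxSet (S j)) (boxSet (V j)))
    (htest : ∀ j < N, hoeBox (T j) (E j) (V j) K ≤ S j)
    (hEV : ∀ j < N, ∀ i < K, ∀ x ∈ boxSet (W j), ∀ a l,
      smoothTaylorFDeriv hf i x (Pi.single l 1) a ∈ EV j i a l)
    (hAK : ∀ j < N, ∀ z ∈ boxSet (S j), ∀ a l,
      smoothTaylorFDeriv hf K z (Pi.single l 1) a ∈ AK j a l)
    (hNN : ∀ j < N, imatmul (AK j) (VV j) ≤ NN j)
    (htestV : ∀ j < N, hoeMatBox (T j) (EV j) (NN j) K ≤ VV j)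
    (hland : ∀ j < N, hoeBox (NonemptyInterval.pure (τ (j + 1) - τ j)) (E j) (V j) K ≤ W (j + 1))
    (hlandV : ∀ j < N,
      imatmul (hoeMatBox (NonemptyInterval.pure (τ (j + 1) - τ j)) (EV j) (NN j) K) (𝒱 j) ≤
        𝒱 (j + 1))
    {y₀ : ι → ℝ} (hy₀ : y₀ ∈ boxSet (W 0)) {M₀ : (ι → ℝ) →L[ℝ] (ι → ℝ)}
    (hM₀ : ∀ a l, M₀ (Pi.single l 1) a ∈ 𝒱 0 a l) :
    (∃ y : ℝ → ι → ℝ, ∃ V' : ℝ → (ι → ℝ) →L[ℝ] (ι → ℝ), y 0 = y₀ ∧ V' 0 = M₀ ∧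
      (∀ t ∈ Icc 0 (τ N), HasDerivWithinAt y (f (y t)) (Icc 0 (τ N)) t) ∧
      ∀ t ∈ Icc 0 (τ N), HasDerivWithinAt V' ((fderiv ℝ f (y t)).comp (V' t)) (Icc 0 (τ N)) t) ∧
    ∀ (y : ℝ → ι → ℝ) (J : ℝ → (ι → ℝ) →L[ℝ] (ι → ℝ)), y 0 = y₀ → J 0 = M₀ →
      (∀ t ∈ Icc 0 (τ N), HasDerivWithinAt y (f (y t)) (Icc 0 (τ N)) t) →
      (∀ t ∈ Icc 0 (τ N), HasDerivWithinAt J ((fderiv ℝ f (y t)).comp (J t)) (Icc 0 (τ N)) t) →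
      (∀ j ≤ N, y (τ j) ∈ boxSet (W j) ∧ ∀ a l, J (τ j) (Pi.single l 1) a ∈ 𝒱 j a l) ∧
      ∀ j < N, ∀ t ∈ Icc (τ j) (τ (j + 1)),
        y t ∈ boxSet (S j) ∧ y t ∈ boxSet (hoeBox (T j) (E j) (V j) K) ∧
        (∀ a l, J t (Pi.single l 1) a ∈ imatmul (VV j) (𝒱 j) a l) ∧
        ∀ a l, J t (Pi.single l 1) a ∈ imatmul (hoeMatBox (T j) (EV j) (NN j) K) (𝒱 j) a l := by
  -- the extended system on the product space and the per-step enclosure relation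
  let P := (ι → ℝ) × ((ι → ℝ) →L[ℝ] (ι → ℝ))
  let F : P → P := variationalField f (fderiv ℝ f)
  let Wp : ℕ → Set P := fun j =>
    {u | u.1 ∈ boxSet (W j) ∧ ∀ a l, u.2 (Pi.single l 1) a ∈ 𝒱 j a l}
  let Q : ℕ → ℝ → P → P → Prop := fun j s u w =>
    (w.1 ∈ boxSet (S j) ∧ ∃ v ∈ boxSet (V j),
      w.1 = (∑ i ∈ Finset.range K, s ^ i • smoothTaylorMap hf i u.1) + s ^ K • v) ∧
    ∃ J₁ : (ι → ℝ) →L[ℝ] (ι → ℝ), w.2 = J₁.comp u.2 ∧ (∀ a l, J₁ (Pi.single l 1) a ∈ VV j a l) ∧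
      ∃ Nm : (ι → ℝ) →L[ℝ] (ι → ℝ), (∀ a l, Nm (Pi.single l 1) a ∈ NN j a l) ∧
        J₁ = (∑ i ∈ Finset.range K, s ^ i • smoothTaylorFDeriv hf i u.1) + s ^ K • Nm
  have hh : ∀ j < N, 0 ≤ τ (j + 1) - τ j := fun j hj => sub_nonneg.2 (hτ j hj)
  -- every solution of the extended system from `Wp j` satisfies `Q j` over step `j`
  have hall : ∀ j < N, ∀ u₀ ∈ Wp j, ∀ u : ℝ → P, u 0 = u₀ →
      (∀ s ∈ Icc 0 (τ (j + 1) - τ j), HasDerivWithinAt u (F (u s)) (Icc 0 (τ (j + 1) - τ j)) s) →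
      ∀ s ∈ Icc 0 (τ (j + 1) - τ j), Q j s u₀ (u s) := by
    intro j hj u₀ hu₀ u hu0 hu s hs
    have hz : ∀ s ∈ Icc 0 (τ (j + 1) - τ j),
        HasDerivWithinAt (fun s => (u s).1) (f (u s).1) (Icc 0 (τ (j + 1) - τ j)) s :=
      fun s hs => hasDerivWithinAt_fst_of_variationalField (hu s hs)
    have hJ : ∀ s ∈ Icc 0 (τ (j + 1) - τ j), HasDerivWithinAt (fun s => (u s).2)
        ((fderiv ℝ f (u s).1).comp (u s).2) (Icc 0 (τ (j + 1) - τ j)) s :=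
      fun s hs => hasDerivWithinAt_snd_of_variationalField (hu s hs)
    have hz0 : (u 0).1 = u₀.1 := by rw [hu0]
    have hJ0 : (u 0).2 = u₀.2 := by rw [hu0]
    obtain ⟨hzS, v, hv, hzeq⟩ := (highOrderEnclosure_step_intervalTest_smoothOn_local hf hK
      (hh j hj) (hT j hj) (W j) (S j) (V j) (E j) (hSΩ j hj) (hE j hj) (hV j hj) (htest j hj)
      hu₀.1).2 (fun s => (u s).1) hz0 hz s hs
    obtain ⟨-, J₁, hJ₁, hVV1, -, Nm, hNm, hJ₁eq⟩ :=
      (variationalEnclosure_comp_intervalTest_smoothOn_local hf hK (hh j hj) (hT j hj) (W j) (S j)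
        (V j) (E j) (EV j) (AK j) (VV j) (NN j) (hSΩ j hj) (hE j hj) (hV j hj) (htest j hj)
        (hEV j hj) (hAK j hj) (hNN j hj) (htestV j hj) hu₀.1 u₀.2).2 (fun s => (u s).1)
        (fun s => (u s).2) hz0 hJ0 hz hJ s hs
    exact ⟨⟨hzS, v, hv, hzeq⟩, J₁, hJ₁, hVV1, Nm, hNm, hJ₁eq⟩
  -- existence over one step from any point of `Wp j`
  have hstep : ∀ j < N, ∀ u₀ ∈ Wp j, ∃ u : ℝ → P, u 0 = u₀ ∧
      (∀ s ∈ Icc 0 (τ (j + 1) - τ j), HasDerivWithinAt u (F (u s)) (Icc 0 (τ (j + 1) - τ j)) s) ∧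
      ∀ s ∈ Icc 0 (τ (j + 1) - τ j), Q j s u₀ (u s) := by
    intro j hj u₀ hu₀
    obtain ⟨y, V', hy0, hV0, hy, hV'⟩ := (variationalEnclosure_comp_intervalTest_smoothOn_local hf
      hK (hh j hj) (hT j hj) (W j) (S j) (V j) (E j) (EV j) (AK j) (VV j) (NN j) (hSΩ j hj)
      (hE j hj) (hV j hj) (htest j hj) (hEV j hj) (hAK j hj) (hNN j hj) (htestV j hj) hu₀.1 u₀.2).1
    have hu : ∀ s ∈ Icc 0 (τ (j + 1) - τ j), HasDerivWithinAt (fun s => (y s, V' s))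
        (F (y s, V' s)) (Icc 0 (τ (j + 1) - τ j)) s :=
      fun s hs => hasDerivWithinAt_variationalField_pair (f' := fderiv ℝ f) (hy s hs) (hV' s hs)
    have hu0 : (fun s => (y s, V' s)) 0 = u₀ := Prod.ext hy0 hV0
    exact ⟨fun s => (y s, V' s), hu0, hu, hall j hj u₀ hu₀ _ hu0 hu⟩
  -- landing: `Q j h_j u₀ w → w ∈ Wp (j+1)`
  have hlandQ : ∀ j < N, ∀ u₀ ∈ Wp j, ∀ w : P, Q j (τ (j + 1) - τ j) u₀ w → w ∈ Wp (j + 1) := by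
    intro j hj u₀ hu₀ w hQ
    obtain ⟨⟨-, v, hv, hw1⟩, J₁, hw2, -, Nm, hNm, hJ₁⟩ := hQ
    refine ⟨?_, ?_⟩
    · rw [hw1]
      exact boxSet_mono (hland j hj)
        (taylorSum_mem_hoeBox (mem_pure_self _) (fun i hi => hE j hj i hi hu₀.1) hv)
    · rw [hw2]
      exact mem_of_imat_le (hlandV j hj) fun a l => comp_single_mem_imatmul
        (jacTaylorSum_single_mem hf (mem_pure_self _) (fun i hi => hEV j hj i hi u₀.1 hu₀.1) hNm
          hJ₁) hu₀.2 a l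
  have hu₀ : ((y₀, M₀) : P) ∈ Wp 0 := ⟨hy₀, hM₀⟩
  refine ⟨?_, ?_⟩
  · -- existence on the whole grid
    obtain ⟨u, hu0, hu, -, -⟩ := exists_solution_of_stepChain (f := F) (W := Wp) (Q := Q) N hτ0
      hτ hstep hlandQ hu₀
    refine ⟨fun t => (u t).1, fun t => (u t).2, by show (u 0).1 = y₀; rw [hu0],
      by show (u 0).2 = M₀; rw [hu0],
      fun t ht => hasDerivWithinAt_fst_of_variationalField (hu t ht),
      fun t ht => hasDerivWithinAt_snd_of_variationalField (hu t ht)⟩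
  · -- every solution pair is enclosed
    intro y J hy0 hJ0 hy hJ
    have hu : ∀ t ∈ Icc 0 (τ N),
        HasDerivWithinAt (fun t => (y t, J t)) (F (y t, J t)) (Icc 0 (τ N)) t :=
      fun t ht => hasDerivWithinAt_variationalField_pair (f' := fderiv ℝ f) (hy t ht) (hJ t ht)
    have hu0W : (fun t => (y t, J t)) 0 ∈ Wp 0 := by
      simp only [hy0, hJ0]; exact hu₀
    obtain ⟨hW, hQ⟩ := solution_mem_of_stepChain (f := F) (W := Wp) (Q := Q) N hτ0 hτ hall
      hlandQ hu0W hu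
    refine ⟨fun j hj => hW j hj, fun j hj t ht => ?_⟩
    obtain ⟨⟨hyS, v, hv, hyt⟩, J₁, hJt, hVV1, Nm, hNm, hJ₁⟩ := hQ j hj t ht
    replace hyt : y t = (∑ i ∈ Finset.range K, (t - τ j) ^ i • smoothTaylorMap hf i (y (τ j))) +
        (t - τ j) ^ K • v := hyt
    replace hJt : J t = J₁.comp (J (τ j)) := hJt
    replace hJ₁ : J₁ = (∑ i ∈ Finset.range K, (t - τ j) ^ i • smoothTaylorFDeriv hf i (y (τ j))) +
        (t - τ j) ^ K • Nm := hJ₁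
    replace hyS : y t ∈ boxSet (S j) := hyS
    have hs : t - τ j ∈ Icc 0 (τ (j + 1) - τ j) := ⟨sub_nonneg.2 ht.1, sub_le_sub_right ht.2 _⟩
    have hyW : y (τ j) ∈ boxSet (W j) := (hW j hj.le).1
    have hJW : ∀ a l, J (τ j) (Pi.single l 1) a ∈ 𝒱 j a l := (hW j hj.le).2
    refine ⟨hyS, ?_, fun a l => ?_, fun a l => ?_⟩
    · rw [hyt]
      exact taylorSum_mem_hoeBox (hT j hj _ hs) (fun i hi => hE j hj i hi hyW) hv
    · rw [hJt]; exact comp_single_mem_imatmul hVV1 hJW a l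
    · rw [hJt]
      exact comp_single_mem_imatmul
        (jacTaylorSum_single_mem hf (hT j hj _ hs) (fun i hi => hEV j hj i hi _ hyW) hNm hJ₁)
        hJW a l

end Chain

/-! ### Polynomial fields: the chain from computed interval data only -/

section Polynomial

variable {ι : Type*} [Fintype ι] [DecidableEq ι]

/-- **The `C¹` chain for a polynomial field with all interval data computed by natural interval
extension.**  For `y' = p(y)` every per-step datum of `variationalChain_boxes_smoothOn_local` is
the natural interval extension of an explicit polynomial (`VariationalEnclosureNaturalExtension`):
the hypotheses are, per step, the two HOE containments (state and Jacobian, initial matrix `Id`)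
and the two landing containments (`W (j+1)` and `𝒱 (j+1) ⊇ (thin-time Jacobian enclosure) · 𝒱 j`),
all between COMPUTED interval objects; the conclusions are existence of the variational pair from
`(y₀, M₀)` on the whole grid and the enclosure of every solution pair: `y (τ j) ∈ W j`,
`J (τ j) ∈ 𝒱 j`, and over each step `y t ∈ S j`, `y t` in the interval Taylor polynomial,
`J t ∈ VV j · 𝒱 j` and `J t ∈ (∑ (T j)^i·EV j i + (T j)^K·NN j) · 𝒱 j`, entrywise.
[cite: WalawskaWilczak2016, §2 (one step of the C¹ algorithm) and §2.1 (C¹ high-order enclosure; inclusion over interval sets)]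
[cite: Moore1979, §3.3 Corollary 3.1 and §8.1 eqs. (8.10), (8.13)] [cite: Zgliczynski2002C1Lohner] -/
theorem variationalChain_naturalExtension_polynomial (p : ι → MvPolynomial ι ℝ) {K : ℕ}
    (hK : 0 < K) {τ : ℕ → ℝ} (N : ℕ) (hτ0 : τ 0 = 0) (hτ : ∀ j < N, τ j ≤ τ (j + 1))
    (T : ℕ → NonemptyInterval ℝ) (hT : ∀ j < N, ∀ t ∈ Icc 0 (τ (j + 1) - τ j), t ∈ T j)
    (W S : ℕ → ι → NonemptyInterval ℝ) (VV 𝒱 : ℕ → ι → ι → NonemptyInterval ℝ)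
    (htest : ∀ j < N, hoeBox (T j) (fun i => polyBoxVec (W j) (taylorPoly p i))
      (polyBoxVec (S j) (taylorPoly p K)) K ≤ S j)
    (htestV : ∀ j < N, hoeMatBox (T j) (fun i => jacPolyBox (W j) (taylorPoly p i))
      (imatmul (jacPolyBox (S j) (taylorPoly p K)) (VV j)) K ≤ VV j)
    (hland : ∀ j < N, hoeBox (NonemptyInterval.pure (τ (j + 1) - τ j))
      (fun i => polyBoxVec (W j) (taylorPoly p i)) (polyBoxVec (S j) (taylorPoly p K)) K ≤
        W (j + 1))
    (hlandV : ∀ j < N, imatmul (hoeMatBox (NonemptyInterval.pure (τ (j + 1) - τ j))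
      (fun i => jacPolyBox (W j) (taylorPoly p i))
      (imatmul (jacPolyBox (S j) (taylorPoly p K)) (VV j)) K) (𝒱 j) ≤ 𝒱 (j + 1))
    {y₀ : ι → ℝ} (hy₀ : y₀ ∈ boxSet (W 0)) {M₀ : (ι → ℝ) →L[ℝ] (ι → ℝ)}
    (hM₀ : ∀ a l, M₀ (Pi.single l 1) a ∈ 𝒱 0 a l) :
    (∃ y : ℝ → ι → ℝ, ∃ V' : ℝ → (ι → ℝ) →L[ℝ] (ι → ℝ), y 0 = y₀ ∧ V' 0 = M₀ ∧
      (∀ t ∈ Icc 0 (τ N), HasDerivWithinAt y (evalVec p (y t)) (Icc 0 (τ N)) t) ∧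
      ∀ t ∈ Icc 0 (τ N),
        HasDerivWithinAt V' ((evalVecFDeriv p (y t)).comp (V' t)) (Icc 0 (τ N)) t) ∧
    ∀ (y : ℝ → ι → ℝ) (J : ℝ → (ι → ℝ) →L[ℝ] (ι → ℝ)), y 0 = y₀ → J 0 = M₀ →
      (∀ t ∈ Icc 0 (τ N), HasDerivWithinAt y (evalVec p (y t)) (Icc 0 (τ N)) t) →
      (∀ t ∈ Icc 0 (τ N),
        HasDerivWithinAt J ((evalVecFDeriv p (y t)).comp (J t)) (Icc 0 (τ N)) t) →
      (∀ j ≤ N, y (τ j) ∈ boxSet (W j) ∧ ∀ a l, J (τ j) (Pi.single l 1) a ∈ 𝒱 j a l) ∧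
      ∀ j < N, ∀ t ∈ Icc (τ j) (τ (j + 1)),
        y t ∈ boxSet (S j) ∧
        y t ∈ boxSet (hoeBox (T j) (fun i => polyBoxVec (W j) (taylorPoly p i))
          (polyBoxVec (S j) (taylorPoly p K)) K) ∧
        (∀ a l, J t (Pi.single l 1) a ∈ imatmul (VV j) (𝒱 j) a l) ∧
        ∀ a l, J t (Pi.single l 1) a ∈ imatmul (hoeMatBox (T j)
          (fun i => jacPolyBox (W j) (taylorPoly p i))
          (imatmul (jacPolyBox (S j) (taylorPoly p K)) (VV j)) K) (𝒱 j) a l := by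
  have hf := contDiffOn_evalVec_top p
  have hE' : ∀ j < N, ∀ i < K, MapsTo (smoothTaylorMap hf i) (boxSet (W j))
      (boxSet (polyBoxVec (W j) (taylorPoly p i))) := fun j _ i _ => by
    rw [smoothTaylorMap_polynomial]; exact mapsTo_taylorMap_polyBoxVec p i (W j)
  have hV' : ∀ j < N, MapsTo (smoothTaylorMap hf K) (boxSet (S j))
      (boxSet (polyBoxVec (S j) (taylorPoly p K))) := fun j _ => by
    rw [smoothTaylorMap_polynomial]; exact mapsTo_taylorMap_polyBoxVec p K (S j)
  have hEV' : ∀ j < N, ∀ i < K, ∀ x ∈ boxSet (W j), ∀ a l,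
      smoothTaylorFDeriv hf i x (Pi.single l 1) a ∈ jacPolyBox (W j) (taylorPoly p i) a l :=
    fun j _ i _ x hx a l => by
    rw [smoothTaylorFDeriv_polynomial]; exact evalVecFDeriv_single_mem_jacPolyBox _ hx a l
  have hAK' : ∀ j < N, ∀ z ∈ boxSet (S j), ∀ a l,
      smoothTaylorFDeriv hf K z (Pi.single l 1) a ∈ jacPolyBox (S j) (taylorPoly p K) a l :=
    fun j _ z hz a l => by
    rw [smoothTaylorFDeriv_polynomial]; exact evalVecFDeriv_single_mem_jacPolyBox _ hz a l
  have hmain := variationalChain_boxes_smoothOn_local hf hK N hτ0 hτ T hT W S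
    (fun j => polyBoxVec (S j) (taylorPoly p K)) (fun j i => polyBoxVec (W j) (taylorPoly p i))
    (fun j i => jacPolyBox (W j) (taylorPoly p i)) (fun j => jacPolyBox (S j) (taylorPoly p K)) VV
    (fun j => imatmul (jacPolyBox (S j) (taylorPoly p K)) (VV j)) 𝒱 (fun _ _ _ _ => trivial)
    hE' hV' htest hEV' hAK' (fun _ _ => le_rfl) htestV hland hlandV hy₀ hM₀
  simpa only [fderiv_evalVec] using hmain

end Polynomial

end Literature.Analysis.ODE

end
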